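import Summits.CriticalPhenomena.PercolationContinuityZ3.Theorems.PercNearOneGluingNoHeavyLowerTailSunflowerMultiPetalSingleton
import HarnessLib
import HarnessLib.Audit

/-!
# `NoHeavyLowerTail` (crux stmt-CriticalPhenomena-4575), abstract sunflower cubic, `k` petals: the LIFT CERTIFICATE for restriction
# monotonicity (MZₖ) — LP weak duality for the one-coordinate step, with flows coloured by up-sets of `M_k`

Support file (seat `prim-l12-p2` gen 34; `--supports stmt-CriticalPhenomena-4575`; companion of `…SunflowerMultiPetalRestriction` (p340634:
`MSunflower.ZKW`, `RestrictionMonotonicityK`) and `…SunflowerMultiPetalSingleton` (p343107)).  No `sorry`, no new definition; nothing is asserted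
about the crux.  Memo: run/shared/lean/prim/prim-l12/prim-l12-p2/FINDING-g34-DUAL-NORMAL-FORM.md.

THE ONE-COORDINATE STEP AS A LINEAR PROGRAMME (gen 7 memo §6, this gen §1).  For `e ∉ W` write `φ X = lab X` and `ψ X = lab (insert e X)`
(`X ⊆ W`); then `ZKW (insert e W) = 3 · Σ_{X ⊆ W} c_X(ψ X)` (`ZKW_insert_eq_three_mul_sum_cost`) with the LIFT COSTS
`c_X(v) := Σ_{S ⊆ W∖X} s6K v (lab S) (lab ((W∖X)∖S))`, and `ZKW W = Σ_X c_X(φ X)`.  So (MZₖ) at `e` says that the modular functional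
`ψ ↦ Σ_X c_X(ψ X)` is at least `ZKW W / 3` at the monotone lift `ψ ≥ φ`.

THEOREM (`MSunflower.ZKW_le_ZKW_insert_of_liftCertificate`, this work) — LP WEAK DUALITY.  Suppose there are potentials `π : Finset α → ℤ` and
nonnegative flows `μ X a L` on the covers `X → insert a X` of `2^W`, coloured by a family `Ls` of UP-SETS `L` of the label order of `M_k`, such that
for every `X ⊆ W` and every admissible value `v ≥ lab X`
  `π X ≤ c_X(v) + Σ_{a ∈ W∖X} Σ_{L ∋ v} μ X a L − Σ_{a ∈ X} Σ_{L ∋ v} μ (X.erase a) a L`     (dual feasibility)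
and `ZKW W ≤ 3 · Σ_{X ⊆ W} π X`.  Then `ZKW W ≤ ZKW (insert e W)`.  Proof: evaluate dual feasibility at `v = ψ X` and sum over `X`; after
re-indexing the inflow sum over `(X.erase a, a)` the flow terms contribute `Σ_{Y,a,L} μ Y a L · ([ψ (insert a Y) ∈ L] − [ψ Y ∈ L]) ≥ 0` because
`ψ` is monotone and each `L` is an up-set.  Whole-cube form: `ZKW_erase_le_ZK_of_liftCertificate`.

WHY (memo §1–§3, kit j213911/j213938/j213943/j214100–102/j214556/j214671): the LP `min_{ψ ≥ φ monotone} Σ_X c_X(ψ X)` has optimum `≥ ZKW W / 3` on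
ALL tested structures (exhaustive 4 points, 3 909; random 5 points; the 104 hard-core 6-point saturated primes minus a point; the n = 6 frontier), so
such certificates exist there; moreover a certificate can always be chosen in the DUAL NORMAL FORM `π X = c_X(lab X)` on every non-bottom `X`, colours
`L ∈ {{⊤, c}, M_k ∖ {0, c}}`, and — when the lifted coordinate is white and `∅` is pinned — with flows emitted by bottom sets only.  Finding the canonical
certificate as a function of the structure is a proof of (MZₖ), hence of `PartitionLemmaK`; this file is the kernel-checked bridge from any explicit
certificate to the inequality.
-/

namespace Summit.CriticalPhenomena.PercolationContinuityZ3.Theorems.SunflowerPartition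

open Finset

variable {α : Type*} [DecidableEq α]

/-- Re-indexing an inflow sum: summing `f (X.erase a) a` over `X ⊆ W`, `a ∈ X` is summing `f Y a` over `Y ⊆ W`, `a ∈ W ∖ Y`. [this work] -/
theorem sum_powerset_sum_erase_eq (W : Finset α) (f : Finset α → α → ℤ) :
    ∑ X ∈ W.powerset, ∑ a ∈ X, f (X.erase a) a = ∑ Y ∈ W.powerset, ∑ a ∈ W \ Y, f Y a := by
  -- both sides equal `Σ_{a ∈ W} Σ_{Y ⊆ W.erase a} f Y a`
  have hL : ∑ X ∈ W.powerset, ∑ a ∈ X, f (X.erase a) a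
      = ∑ a ∈ W, ∑ X ∈ W.powerset.filter (fun X => a ∈ X), f (X.erase a) a := by
    rw [sum_comm' (t' := W) (s' := fun a => W.powerset.filter (fun X => a ∈ X))]
    intro X a
    simp only [mem_powerset, mem_filter]
    constructor
    · rintro ⟨hX, ha⟩; exact ⟨⟨hX, ha⟩, hX ha⟩
    · rintro ⟨⟨hX, ha⟩, _⟩; exact ⟨hX, ha⟩
  have hR : ∑ Y ∈ W.powerset, ∑ a ∈ W \ Y, f Y a
      = ∑ a ∈ W, ∑ Y ∈ W.powerset.filter (fun Y => a ∉ Y), f Y a := by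
    rw [sum_comm' (t' := W) (s' := fun a => W.powerset.filter (fun Y => a ∉ Y))]
    intro Y a
    simp only [mem_powerset, mem_filter, mem_sdiff]
    constructor
    · rintro ⟨hY, haW, haY⟩; exact ⟨⟨hY, haY⟩, haW⟩
    · rintro ⟨⟨hY, haY⟩, haW⟩; exact ⟨hY, haW, haY⟩
  rw [hL, hR]
  refine sum_congr rfl fun a ha => ?_
  -- bijection `X ↦ X.erase a` from `{X ⊆ W : a ∈ X}` to `{Y ⊆ W : a ∉ Y}`, inverse `insert a`
  refine sum_nbij' (fun X => X.erase a) (fun Y => insert a Y) ?_ ?_ ?_ ?_ ?_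
  · intro X hX
    simp only [mem_filter, mem_powerset] at hX ⊢
    exact ⟨fun x hx => hX.1 (mem_of_mem_erase hx), fun h => (mem_erase.1 h).1 rfl⟩
  · intro Y hY
    simp only [mem_filter, mem_powerset] at hY ⊢
    exact ⟨insert_subset ha hY.1, mem_insert_self a Y⟩
  · intro X hX
    simp only [mem_filter, mem_powerset] at hX
    exact insert_erase hX.2
  · intro Y hY
    simp only [mem_filter, mem_powerset] at hY
    exact erase_insert hY.2
  · intro X _
    rfl

namespace MSunflower

variable {k : ℕ} (F : MSunflower k α)

/-- The sub-cube functional as a sum of LIFT COSTS at the true labels: `ZKW W = Σ_{X ⊆ W} c_X(lab X)`,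
`c_X(v) = Σ_{S ⊆ W∖X} s6K v (lab S) (lab ((W∖X)∖S))` (definitional). [this work] -/
theorem ZKW_eq_sum_cost (W : Finset α) :
    F.ZKW W = ∑ X ∈ W.powerset, ∑ S ∈ (W \ X).powerset, s6K k (F.lab X) (F.lab S) (F.lab ((W \ X) \ S)) := rfl

/-- **One-coordinate expansion**: for `e ∉ W`, `ZKW (insert e W) = 3 · Σ_{X ⊆ W} c_X(lab (insert e X))` — the new coordinate sits in exactly one
of the three blocks, and by the symmetry of `s6K` the three cases contribute equally. [this work] -/
theorem ZKW_insert_eq_three_mul_sum_cost (W : Finset α) (e : α) (he : e ∉ W) :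
    F.ZKW (insert e W)
      = 3 * ∑ X ∈ W.powerset, ∑ S ∈ (W \ X).powerset, s6K k (F.lab (insert e X)) (F.lab S) (F.lab ((W \ X) \ S)) := by
  -- symmetry of the kernel (the landed `s6K_swap12/23` live in `…MultiPetalModuleLift`, whose olean is not yet available to importers)
  have hc12 : ∀ x y z : Fin (k + 2), s6K k y x z = s6K k x y z := by
    intro x y z
    unfold s6K
    have h : (if y ≠ x ∧ x ≠ z ∧ y ≠ z then (1 : ℤ) else 0) = if x ≠ y ∧ y ≠ z ∧ x ≠ z then 1 else 0 := by
      by_cases h1 : x ≠ y ∧ y ≠ z ∧ x ≠ z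
      · rw [if_pos h1, if_pos ⟨fun h => h1.1 h.symm, h1.2.2, h1.2.1⟩]
      · rw [if_neg h1, if_neg (fun h2 => h1 ⟨fun h => h2.1 h.symm, h2.2.2, h2.2.1⟩)]
    rw [h]
    ring
  have hc23 : ∀ x y z : Fin (k + 2), s6K k x z y = s6K k x y z := by
    intro x y z
    unfold s6K
    have h : (if x ≠ z ∧ z ≠ y ∧ x ≠ y then (1 : ℤ) else 0) = if x ≠ y ∧ y ≠ z ∧ x ≠ z then 1 else 0 := by
      by_cases h1 : x ≠ y ∧ y ≠ z ∧ x ≠ z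
      · rw [if_pos h1, if_pos ⟨h1.2.2, fun h => h1.2.1 h.symm, h1.1⟩]
      · rw [if_neg h1, if_neg (fun h2 => h1 ⟨h2.2.2, fun h => h2.2.1 h.symm, h2.1⟩)]
    rw [h]
    ring
  have hcyc : ∀ x y z : Fin (k + 2), s6K k y z x = s6K k x y z := by
    intro x y z
    rw [hc23 y x z, hc12 x y z]
  unfold ZKW
  rw [nested_insert_split W e he]
  have h2 : nested W (fun X S T => s6K k (F.lab X) (F.lab (insert e S)) (F.lab T))
      = nested W (fun X S T => s6K k (F.lab (insert e X)) (F.lab S) (F.lab T)) := by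
    rw [nested_swap12 W (fun X S T => s6K k (F.lab X) (F.lab (insert e S)) (F.lab T))]
    unfold nested
    refine sum_congr rfl fun X _ => sum_congr rfl fun S _ => ?_
    exact hc12 _ _ _
  have h3 : nested W (fun X S T => s6K k (F.lab X) (F.lab S) (F.lab (insert e T)))
      = nested W (fun X S T => s6K k (F.lab (insert e X)) (F.lab S) (F.lab T)) := by
    rw [nested_swap23 W (fun X S T => s6K k (F.lab X) (F.lab S) (F.lab (insert e T)))]
    rw [nested_swap12 W (fun X S T => s6K k (F.lab X) (F.lab T) (F.lab (insert e S)))]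
    unfold nested
    refine sum_congr rfl fun X _ => sum_congr rfl fun S _ => ?_
    exact hcyc _ _ _
  rw [h2, h3]
  unfold nested
  ring

/-- **THE LIFT CERTIFICATE (LP weak duality for (MZₖ) at one coordinate)** (this work).  Let `e ∉ W`, let `Ls` be a family of up-sets of the
label order of `M_k` (`a ∈ L`, `a ≤ b` ⟹ `b ∈ L`, where `a ≤ b` iff `a = b ∨ a = 0 ∨ b = ⊤`), `π` potentials on the sub-cubes of `W` and `μ X a L ≥ 0`
flows on the covers `X → insert a X` coloured by `L ∈ Ls`.  If for every `X ⊆ W` and every admissible value `v` (`lab X ≤ v`)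
`π X ≤ c_X(v) + (outflow at X on colours containing v) − (inflow at X on colours containing v)`, and `ZKW W ≤ 3 Σ_X π X`,
then `ZKW W ≤ ZKW (insert e W)`. [this work] -/
theorem ZKW_le_ZKW_insert_of_liftCertificate (W : Finset α) (e : α) (he : e ∉ W)
    (Ls : Finset (Finset (Fin (k + 2))))
    (hLs : ∀ L ∈ Ls, ∀ a b : Fin (k + 2), a ∈ L → (a = b ∨ a = 0 ∨ b = Fin.last (k + 1)) → b ∈ L)
    (π : Finset α → ℤ) (μ : Finset α → α → Finset (Fin (k + 2)) → ℤ)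
    (hμ : ∀ X a L, 0 ≤ μ X a L)
    (hπ : ∀ X ∈ W.powerset, ∀ v : Fin (k + 2), (F.lab X = v ∨ F.lab X = 0 ∨ v = Fin.last (k + 1)) →
        π X ≤ (∑ S ∈ (W \ X).powerset, s6K k v (F.lab S) (F.lab ((W \ X) \ S)))
              + (∑ a ∈ W \ X, ∑ L ∈ Ls.filter (fun L => v ∈ L), μ X a L)
              - (∑ a ∈ X, ∑ L ∈ Ls.filter (fun L => v ∈ L), μ (X.erase a) a L))
    (hsum : F.ZKW W ≤ 3 * ∑ X ∈ W.powerset, π X) :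
    F.ZKW W ≤ F.ZKW (insert e W) := by
  rw [F.ZKW_insert_eq_three_mul_sum_cost W e he]
  -- dual feasibility at `v = ψ X = lab (insert e X)`
  have hfeas : ∀ X ∈ W.powerset,
      π X + (∑ a ∈ X, ∑ L ∈ Ls.filter (fun L => F.lab (insert e X) ∈ L), μ (X.erase a) a L)
        - (∑ a ∈ W \ X, ∑ L ∈ Ls.filter (fun L => F.lab (insert e X) ∈ L), μ X a L)
        ≤ ∑ S ∈ (W \ X).powerset, s6K k (F.lab (insert e X)) (F.lab S) (F.lab ((W \ X) \ S)) := by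
    intro X hX
    have hadm : F.lab X = F.lab (insert e X) ∨ F.lab X = 0 ∨ F.lab (insert e X) = Fin.last (k + 1) :=
      F.lab_mono (subset_insert e X)
    have h := hπ X hX (F.lab (insert e X)) hadm
    linarith
  have hstep : (∑ X ∈ W.powerset, π X)
      + ((∑ X ∈ W.powerset, ∑ a ∈ X, ∑ L ∈ Ls.filter (fun L => F.lab (insert e X) ∈ L), μ (X.erase a) a L)
        - (∑ X ∈ W.powerset, ∑ a ∈ W \ X, ∑ L ∈ Ls.filter (fun L => F.lab (insert e X) ∈ L), μ X a L))
      ≤ ∑ X ∈ W.powerset, ∑ S ∈ (W \ X).powerset, s6K k (F.lab (insert e X)) (F.lab S) (F.lab ((W \ X) \ S)) := by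
    have h := sum_le_sum hfeas
    rw [sum_sub_distrib, sum_add_distrib] at h
    linarith
  -- the flow terms: inflow (re-indexed) dominates outflow, because `ψ` is monotone and every colour is an up-set
  have hre : (∑ X ∈ W.powerset, ∑ a ∈ X, ∑ L ∈ Ls.filter (fun L => F.lab (insert e X) ∈ L), μ (X.erase a) a L)
      = ∑ Y ∈ W.powerset, ∑ a ∈ W \ Y, ∑ L ∈ Ls.filter (fun L => F.lab (insert e (insert a Y)) ∈ L), μ Y a L := by
    rw [← sum_powerset_sum_erase_eq W (fun Y a => ∑ L ∈ Ls.filter (fun L => F.lab (insert e (insert a Y)) ∈ L), μ Y a L)]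
    refine sum_congr rfl fun X _ => sum_congr rfl fun a ha => ?_
    rw [insert_erase ha]
  have hflow : (∑ X ∈ W.powerset, ∑ a ∈ W \ X, ∑ L ∈ Ls.filter (fun L => F.lab (insert e X) ∈ L), μ X a L)
      ≤ ∑ X ∈ W.powerset, ∑ a ∈ X, ∑ L ∈ Ls.filter (fun L => F.lab (insert e X) ∈ L), μ (X.erase a) a L := by
    rw [hre]
    refine sum_le_sum fun Y _ => sum_le_sum fun a _ => ?_
    refine sum_le_sum_of_subset_of_nonneg ?_ (fun L _ _ => hμ Y a L)
    intro L hL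
    simp only [mem_filter] at hL ⊢
    refine ⟨hL.1, hLs L hL.1 (F.lab (insert e Y)) (F.lab (insert e (insert a Y))) hL.2 ?_⟩
    exact F.lab_mono (insert_subset_insert e (subset_insert a Y))
  linarith

/-- **Whole-cube form** (this work): a lift certificate on `W = univ.erase e` gives `ZKW (univ.erase e) ≤ ZK`, i.e. (MZₖ) at the coordinate `e`
of the whole structure. [this work] -/
theorem ZKW_erase_le_ZK_of_liftCertificate [Fintype α] (e : α)
    (Ls : Finset (Finset (Fin (k + 2))))
    (hLs : ∀ L ∈ Ls, ∀ a b : Fin (k + 2), a ∈ L → (a = b ∨ a = 0 ∨ b = Fin.last (k + 1)) → b ∈ L)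
    (π : Finset α → ℤ) (μ : Finset α → α → Finset (Fin (k + 2)) → ℤ)
    (hμ : ∀ X a L, 0 ≤ μ X a L)
    (hπ : ∀ X ∈ (univ.erase e).powerset, ∀ v : Fin (k + 2), (F.lab X = v ∨ F.lab X = 0 ∨ v = Fin.last (k + 1)) →
        π X ≤ (∑ S ∈ (univ.erase e \ X).powerset, s6K k v (F.lab S) (F.lab ((univ.erase e \ X) \ S)))
              + (∑ a ∈ univ.erase e \ X, ∑ L ∈ Ls.filter (fun L => v ∈ L), μ X a L)
              - (∑ a ∈ X, ∑ L ∈ Ls.filter (fun L => v ∈ L), μ (X.erase a) a L))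
    (hsum : F.ZKW (univ.erase e) ≤ 3 * ∑ X ∈ (univ.erase e).powerset, π X) :
    F.ZKW (univ.erase e) ≤ F.ZK := by
  have h := F.ZKW_le_ZKW_insert_of_liftCertificate (univ.erase e) e (notMem_erase e univ) Ls hLs π μ hμ hπ hsum
  rwa [insert_erase (mem_univ e), ZKW_univ] at h

/-! ## The exact one-coordinate accounting (gen 34, memo §4) and (MZₖ) for `k ≤ 2`

With `φ = lab`, `ψ = lab (insert e ·)` on the sub-cubes of `W` (`e ∉ W`), the spectator form `s6K = Σ_cyc [decided]·kkK − triK` (p339016) turns the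
lift-cost sum into Gladkov sums: writing `g_X := Σ_{S ⊆ W∖X} kkK (φ S) (φ T)` (antipodal Gladkov sum of the cube `W ∖ X`, `T` the complement of `S` in it)
and `M_X := Σ_{S ⊆ W∖X} kkK (ψ S) (φ T)` (the MIXED sum, one side lifted),
  `Σ_X c_X(v X) = Σ_X [v X decided]·g_X + 2·Σ_X [φ X decided]·(Σ_S kkK (v S) (φ T)) − Σ_X Σ_S triK (v X) (φ S) (φ T)`  (`sum_cost_eq_spec`),
hence the EXACT IDENTITY (`ZKW_insert_sub_ZKW_eq`)
  `ZKW (insert e W) − ZKW W = 3·Σ_X [ψX dec]·g_X + 3·Σ_X [φX dec]·(2·M_X − g_X) − (3·R₁ − R₀)`,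
`R₁ = Σ_X Σ_S triK (ψ X) (φ S) (φ T)` (rainbows with the first block lifted), `R₀ = Σ_X Σ_S triK (φ X) (φ S) (φ T)`.  Here `g_X ≥ 0` (antipodal Gladkov) and
`2·M_X ≥ g_X + g^ψ_X ≥ g_X` (`kkK_submod` summed over antipodal pairs, `g^ψ_X ≥ 0` by antipodal Gladkov with offsets `{e} ⊇ {e}`): `two_mul_mixed_ge`.
For `k ≤ 2` there are no rainbows (`triK ≡ 0`), so **(MZₖ) holds for every structure with at most two petals** (`ZKW_le_ZKW_insert_of_le_two`,
`restrictionMonotonicityK` restricted to `k ≤ 2`); for `k ≥ 3` the identity isolates the enemy `3R₁ − R₀`.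
-/

/-- Reversing an antipodal sum over a cube: `Σ_{S ⊆ V} f S (V∖S) = Σ_{S ⊆ V} f (V∖S) S`. [folklore] -/
theorem sum_powerset_antipodal_comm (V : Finset α) (f : Finset α → Finset α → ℤ) :
    ∑ S ∈ V.powerset, f S (V \ S) = ∑ S ∈ V.powerset, f (V \ S) S := by
  refine sum_nbij' (fun S => V \ S) (fun S => V \ S) ?_ ?_ ?_ ?_ ?_
  · intro S _; exact mem_powerset.2 sdiff_subset
  · intro S _; exact mem_powerset.2 sdiff_subset
  · intro S hS; exact Finset.sdiff_sdiff_eq_self (mem_powerset.1 hS)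
  · intro S hS; exact Finset.sdiff_sdiff_eq_self (mem_powerset.1 hS)
  · intro S hS; rw [Finset.sdiff_sdiff_eq_self (mem_powerset.1 hS)]

/-- **Twice the mixed antipodal sum dominates the pure one** (this work): for `e ∉ V`,
`Σ_{S⊆V} kkK (lab S) (lab (V∖S)) ≤ 2 · Σ_{S ⊆ V} kkK (lab (insert e S)) (lab (V∖S))` — `kkK_submod` on each antipodal pair (the lift `lab ≤ lab (insert e ·)`
is comparable on both sides), the reversed mixed sum equals the mixed sum, and the doubly-lifted sum is `≥ 0` (antipodal Gladkov with offsets `{e} ⊇ {e}`). [this work] -/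
theorem two_mul_mixed_ge (V : Finset α) (e : α) :
    ∑ S ∈ V.powerset, kkK k (F.lab S) (F.lab (V \ S))
      ≤ 2 * ∑ S ∈ V.powerset, kkK k (F.lab (insert e S)) (F.lab (V \ S)) := by
  -- pointwise submodularity
  have hsub : ∀ S ∈ V.powerset,
      kkK k (F.lab S) (F.lab (V \ S)) + kkK k (F.lab (insert e S)) (F.lab (insert e (V \ S)))
        ≤ kkK k (F.lab (insert e S)) (F.lab (V \ S)) + kkK k (F.lab S) (F.lab (insert e (V \ S))) := by
    intro S _
    exact kkK_submod _ _ _ _ (F.lab_mono (subset_insert e S)) (F.lab_mono (subset_insert e (V \ S)))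
  have h1 := sum_le_sum hsub
  rw [sum_add_distrib, sum_add_distrib] at h1
  -- the reversed mixed sum equals the mixed sum
  have hrev : ∑ S ∈ V.powerset, kkK k (F.lab S) (F.lab (insert e (V \ S)))
      = ∑ S ∈ V.powerset, kkK k (F.lab (insert e S)) (F.lab (V \ S)) := by
    rw [sum_powerset_antipodal_comm V (fun S T => kkK k (F.lab S) (F.lab (insert e T)))]
    exact sum_congr rfl fun S _ => kkK_comm k _ _
  -- the doubly lifted sum is nonnegative
  have hpos : 0 ≤ ∑ S ∈ V.powerset, kkK k (F.lab (insert e S)) (F.lab (insert e (V \ S))) := by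
    have h := F.antipodal_sum_nonneg V {e} {e} (subset_refl _)
    refine le_trans h (le_of_eq (sum_congr rfl fun S _ => ?_))
    rw [← insert_eq, ← insert_eq]
  rw [hrev] at h1
  linarith

/-- **Spectator decomposition of a lift-cost sum** (this work): for any block-valued `v` on the sub-cubes of `W`,
`Σ_X Σ_{S⊆W∖X} s6K (v X) (lab S) (lab T) = Σ_X Σ_S decK (v X)·kkK (lab S) (lab T) + 2·Σ_X Σ_S decK (lab X)·kkK (v S) (lab T) − Σ_X Σ_S triK (v X) (lab S) (lab T)`
(`T` the complement of `S` in `W ∖ X`; the two sums with a decided non-spectator block are moved to the spectator position by the block symmetries). [this work] -/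
theorem sum_cost_eq_spec (W : Finset α) (v : Finset α → Fin (k + 2)) :
    ∑ X ∈ W.powerset, ∑ S ∈ (W \ X).powerset, s6K k (v X) (F.lab S) (F.lab ((W \ X) \ S))
      = (∑ X ∈ W.powerset, ∑ S ∈ (W \ X).powerset, decK k (v X) * kkK k (F.lab S) (F.lab ((W \ X) \ S)))
        + 2 * (∑ X ∈ W.powerset, ∑ S ∈ (W \ X).powerset, decK k (F.lab X) * kkK k (v S) (F.lab ((W \ X) \ S)))
        - ∑ X ∈ W.powerset, ∑ S ∈ (W \ X).powerset, triK k (v X) (F.lab S) (F.lab ((W \ X) \ S)) := by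
  -- expand the kernel pointwise
  have hexp : ∑ X ∈ W.powerset, ∑ S ∈ (W \ X).powerset, s6K k (v X) (F.lab S) (F.lab ((W \ X) \ S))
      = nested W (fun X S T => decK k (v X) * kkK k (F.lab S) (F.lab T))
        + nested W (fun X S T => decK k (F.lab S) * kkK k (v X) (F.lab T))
        + nested W (fun X S T => decK k (F.lab T) * kkK k (v X) (F.lab S))
        - nested W (fun X S T => triK k (v X) (F.lab S) (F.lab T)) := by
    unfold nested
    rw [← sum_add_distrib, ← sum_add_distrib, ← sum_sub_distrib]
    refine sum_congr rfl fun X _ => ?_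
    rw [← sum_add_distrib, ← sum_add_distrib, ← sum_sub_distrib]
    refine sum_congr rfl fun S _ => ?_
    rw [s6K_eq_spec]
  -- move the decided block to the spectator position in the second and third sums
  have h2 : nested W (fun X S T => decK k (F.lab S) * kkK k (v X) (F.lab T))
      = nested W (fun X S T => decK k (F.lab X) * kkK k (v S) (F.lab T)) :=
    nested_swap12 W (fun X S T => decK k (F.lab S) * kkK k (v X) (F.lab T))
  have h3 : nested W (fun X S T => decK k (F.lab T) * kkK k (v X) (F.lab S))
      = nested W (fun X S T => decK k (F.lab X) * kkK k (v S) (F.lab T)) := by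
    rw [nested_swap23 W (fun X S T => decK k (F.lab T) * kkK k (v X) (F.lab S))]
    exact nested_swap12 W (fun X S T => decK k (F.lab S) * kkK k (v X) (F.lab T))
  rw [hexp, h2, h3]
  unfold nested
  ring

/-- **The exact one-coordinate identity** (this work, memo §4): for `e ∉ W`, with `φ = lab`, `ψ = lab (insert e ·)`,
`ZKW (insert e W) − ZKW W = 3·Σ_X Σ_S [ψX dec]·kkK(φS,φT) + 3·(2·Σ_X Σ_S [φX dec]·kkK(ψS,φT) − Σ_X Σ_S [φX dec]·kkK(φS,φT)) − (3 R₁ − R₀)`. [this work] -/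
theorem ZKW_insert_sub_ZKW_eq (W : Finset α) (e : α) (he : e ∉ W) :
    F.ZKW (insert e W) - F.ZKW W
      = 3 * (∑ X ∈ W.powerset, ∑ S ∈ (W \ X).powerset, decK k (F.lab (insert e X)) * kkK k (F.lab S) (F.lab ((W \ X) \ S)))
        + 3 * (2 * (∑ X ∈ W.powerset, ∑ S ∈ (W \ X).powerset, decK k (F.lab X) * kkK k (F.lab (insert e S)) (F.lab ((W \ X) \ S)))
            - ∑ X ∈ W.powerset, ∑ S ∈ (W \ X).powerset, decK k (F.lab X) * kkK k (F.lab S) (F.lab ((W \ X) \ S)))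
        - (3 * (∑ X ∈ W.powerset, ∑ S ∈ (W \ X).powerset, triK k (F.lab (insert e X)) (F.lab S) (F.lab ((W \ X) \ S)))
            - ∑ X ∈ W.powerset, ∑ S ∈ (W \ X).powerset, triK k (F.lab X) (F.lab S) (F.lab ((W \ X) \ S))) := by
  rw [F.ZKW_insert_eq_three_mul_sum_cost W e he, F.ZKW_eq_sum_cost W,
    F.sum_cost_eq_spec W (fun X => F.lab (insert e X)), F.sum_cost_eq_spec W (fun X => F.lab X)]
  ring

/-- **(MZₖ) for at most two petals** (this work): if `k ≤ 2` then `ZKW W ≤ ZKW (insert e W)` for every `e ∉ W` — there are no rainbows, and in the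
exact identity every remaining term is nonnegative (`antipodal_gladkov`, `two_mul_mixed_ge`). [this work] -/
theorem ZKW_le_ZKW_insert_of_le_two (hk : k ≤ 2) (W : Finset α) (e : α) (he : e ∉ W) :
    F.ZKW W ≤ F.ZKW (insert e W) := by
  have hid := F.ZKW_insert_sub_ZKW_eq W e he
  have hR₁ : ∑ X ∈ W.powerset, ∑ S ∈ (W \ X).powerset, triK k (F.lab (insert e X)) (F.lab S) (F.lab ((W \ X) \ S)) = 0 :=
    sum_eq_zero fun X _ => sum_eq_zero fun S _ => triK_eq_zero_of_le_two hk _ _ _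
  have hR₀ : ∑ X ∈ W.powerset, ∑ S ∈ (W \ X).powerset, triK k (F.lab X) (F.lab S) (F.lab ((W \ X) \ S)) = 0 :=
    sum_eq_zero fun X _ => sum_eq_zero fun S _ => triK_eq_zero_of_le_two hk _ _ _
  have hdec : ∀ x : Fin (k + 2), 0 ≤ decK k x := by
    intro x; unfold decK; split_ifs <;> norm_num
  have h1 : 0 ≤ ∑ X ∈ W.powerset, ∑ S ∈ (W \ X).powerset, decK k (F.lab (insert e X)) * kkK k (F.lab S) (F.lab ((W \ X) \ S)) := by
    refine sum_nonneg fun X _ => ?_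
    rw [← mul_sum]
    exact mul_nonneg (hdec _) (F.antipodal_gladkov (W \ X))
  have h2 : ∑ X ∈ W.powerset, ∑ S ∈ (W \ X).powerset, decK k (F.lab X) * kkK k (F.lab S) (F.lab ((W \ X) \ S))
      ≤ 2 * ∑ X ∈ W.powerset, ∑ S ∈ (W \ X).powerset, decK k (F.lab X) * kkK k (F.lab (insert e S)) (F.lab ((W \ X) \ S)) := by
    rw [mul_sum]
    refine sum_le_sum fun X _ => ?_
    rw [← mul_sum, ← mul_sum]
    have hm := F.two_mul_mixed_ge (W \ X) e
    have hd := hdec (F.lab X)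
    nlinarith
  rw [hR₁, hR₀] at hid
  linarith

/-- Whole-type corollary: **`RestrictionMonotonicityK` holds for every structure with at most two petals** (this work; the case `k ≤ 2` of the conjecture
p340634; ★ₖ for `k ≤ 2` itself is p339016's `ZK_nonneg_of_le_two`). [this work] -/
theorem restrictionMonotonicityK_of_le_two (hk : k ≤ 2) (W : Finset α) (e : α) (he : e ∉ W) :
    F.ZKW W ≤ F.ZKW (insert e W) :=
  F.ZKW_le_ZKW_insert_of_le_two hk W e he

/-! ## Certificates for ★ₖ directly (gen 34, memo §11 'LP₀'): the same weak duality with target `0` — a lift certificate with `0 ≤ Σ π` proves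
`0 ≤ ZKW (insert e W)` with no hypothesis on `ZKW W` (the target `0` shows no integrality gap in the data, unlike `ZKW W / 3`, memo §10). -/

/-- **Lift certificate for ★ₖ on the bigger cube** (this work): with the hypotheses of `ZKW_le_ZKW_insert_of_liftCertificate` but only `0 ≤ Σ_X π X`, one gets
`0 ≤ ZKW (insert e W)`. [this work] -/
theorem ZKW_insert_nonneg_of_liftCertificate (W : Finset α) (e : α) (he : e ∉ W)
    (Ls : Finset (Finset (Fin (k + 2))))
    (hLs : ∀ L ∈ Ls, ∀ a b : Fin (k + 2), a ∈ L → (a = b ∨ a = 0 ∨ b = Fin.last (k + 1)) → b ∈ L)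
    (π : Finset α → ℤ) (μ : Finset α → α → Finset (Fin (k + 2)) → ℤ)
    (hμ : ∀ X a L, 0 ≤ μ X a L)
    (hπ : ∀ X ∈ W.powerset, ∀ v : Fin (k + 2), (F.lab X = v ∨ F.lab X = 0 ∨ v = Fin.last (k + 1)) →
        π X ≤ (∑ S ∈ (W \ X).powerset, s6K k v (F.lab S) (F.lab ((W \ X) \ S)))
              + (∑ a ∈ W \ X, ∑ L ∈ Ls.filter (fun L => v ∈ L), μ X a L)
              - (∑ a ∈ X, ∑ L ∈ Ls.filter (fun L => v ∈ L), μ (X.erase a) a L))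
    (hsum : 0 ≤ ∑ X ∈ W.powerset, π X) :
    0 ≤ F.ZKW (insert e W) := by
  rw [F.ZKW_insert_eq_three_mul_sum_cost W e he]
  have hfeas : ∀ X ∈ W.powerset,
      π X + (∑ a ∈ X, ∑ L ∈ Ls.filter (fun L => F.lab (insert e X) ∈ L), μ (X.erase a) a L)
        - (∑ a ∈ W \ X, ∑ L ∈ Ls.filter (fun L => F.lab (insert e X) ∈ L), μ X a L)
        ≤ ∑ S ∈ (W \ X).powerset, s6K k (F.lab (insert e X)) (F.lab S) (F.lab ((W \ X) \ S)) := by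
    intro X hX
    have h := hπ X hX (F.lab (insert e X)) (F.lab_mono (subset_insert e X))
    linarith
  have hstep : (∑ X ∈ W.powerset, π X)
      + ((∑ X ∈ W.powerset, ∑ a ∈ X, ∑ L ∈ Ls.filter (fun L => F.lab (insert e X) ∈ L), μ (X.erase a) a L)
        - (∑ X ∈ W.powerset, ∑ a ∈ W \ X, ∑ L ∈ Ls.filter (fun L => F.lab (insert e X) ∈ L), μ X a L))
      ≤ ∑ X ∈ W.powerset, ∑ S ∈ (W \ X).powerset, s6K k (F.lab (insert e X)) (F.lab S) (F.lab ((W \ X) \ S)) := by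
    have h := sum_le_sum hfeas
    rw [sum_sub_distrib, sum_add_distrib] at h
    linarith
  have hre : (∑ X ∈ W.powerset, ∑ a ∈ X, ∑ L ∈ Ls.filter (fun L => F.lab (insert e X) ∈ L), μ (X.erase a) a L)
      = ∑ Y ∈ W.powerset, ∑ a ∈ W \ Y, ∑ L ∈ Ls.filter (fun L => F.lab (insert e (insert a Y)) ∈ L), μ Y a L := by
    rw [← sum_powerset_sum_erase_eq W (fun Y a => ∑ L ∈ Ls.filter (fun L => F.lab (insert e (insert a Y)) ∈ L), μ Y a L)]
    refine sum_congr rfl fun X _ => sum_congr rfl fun a ha => ?_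
    rw [insert_erase ha]
  have hflow : (∑ X ∈ W.powerset, ∑ a ∈ W \ X, ∑ L ∈ Ls.filter (fun L => F.lab (insert e X) ∈ L), μ X a L)
      ≤ ∑ X ∈ W.powerset, ∑ a ∈ X, ∑ L ∈ Ls.filter (fun L => F.lab (insert e X) ∈ L), μ (X.erase a) a L := by
    rw [hre]
    refine sum_le_sum fun Y _ => sum_le_sum fun a _ => ?_
    refine sum_le_sum_of_subset_of_nonneg ?_ (fun L _ _ => hμ Y a L)
    intro L hL
    simp only [mem_filter] at hL ⊢
    refine ⟨hL.1, hLs L hL.1 (F.lab (insert e Y)) (F.lab (insert e (insert a Y))) hL.2 ?_⟩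
    exact F.lab_mono (insert_subset_insert e (subset_insert a Y))
  linarith

/-- Whole-type form: a lift certificate with `0 ≤ Σ π` on `W = univ.erase e` proves **★ₖ for the structure itself**: `0 ≤ ZK`. [this work] -/
theorem ZK_nonneg_of_liftCertificate [Fintype α] (e : α)
    (Ls : Finset (Finset (Fin (k + 2))))
    (hLs : ∀ L ∈ Ls, ∀ a b : Fin (k + 2), a ∈ L → (a = b ∨ a = 0 ∨ b = Fin.last (k + 1)) → b ∈ L)
    (π : Finset α → ℤ) (μ : Finset α → α → Finset (Fin (k + 2)) → ℤ)
    (hμ : ∀ X a L, 0 ≤ μ X a L)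
    (hπ : ∀ X ∈ (univ.erase e).powerset, ∀ v : Fin (k + 2), (F.lab X = v ∨ F.lab X = 0 ∨ v = Fin.last (k + 1)) →
        π X ≤ (∑ S ∈ (univ.erase e \ X).powerset, s6K k v (F.lab S) (F.lab ((univ.erase e \ X) \ S)))
              + (∑ a ∈ univ.erase e \ X, ∑ L ∈ Ls.filter (fun L => v ∈ L), μ X a L)
              - (∑ a ∈ X, ∑ L ∈ Ls.filter (fun L => v ∈ L), μ (X.erase a) a L))
    (hsum : 0 ≤ ∑ X ∈ (univ.erase e).powerset, π X) :
    0 ≤ F.ZK := by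
  have h := F.ZKW_insert_nonneg_of_liftCertificate (univ.erase e) e (notMem_erase e univ) Ls hLs π μ hμ hπ hsum
  rwa [insert_erase (mem_univ e), ZKW_univ] at h

end MSunflower

end Summit.CriticalPhenomena.PercolationContinuityZ3.Theorems.SunflowerPartition
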